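import Summits.SmoothPoincare4.SmoothPoincare4.Theorems.CylinderEntropyCylinderRungTwoDissipationBudget
import Summits.SmoothPoincare4.SmoothPoincare4.Theorems.CylinderEntropyCylinderRungTwoSlabConfinement
import Mathlib.MeasureTheory.Integral.Average
import HarnessLib

/-!
# Route `CylinderEntropy`, crux `CylinderRungTwo` (stmt-SmoothPoincare4-7631), line `killing-flux`:
# restart, monotone height envelope and GOOD TIMES of a cylinder flow
# (registered helpers `helper_heightEnvelopeMonotone` and `helper_goodTimes`, lead c4, wave 2, F2)

Along a smooth mean curvature flow `IsCylinderMCF M F ν T`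
(`CylinderEntropyCylinderRungTwoKillingFluxDefs.lean`) of closed embedded cross-sections of
`N = S⁴ × ℝ ⊂ ℝ⁶` write

  `E(r) = ∫⁻_M ‖∂_r F(r, x)‖² d((F r)^* μH⁴)(x)`  (the slice energy, classically `∫_{M_r} H² dμ_r`),
  `W(s) = ∫⁻_{r ∈ [s, s+1]} E(r) dr`             (the dissipation over a unit window).

* `IsCylinderMCF.of_le` — RESTART: a cylinder flow on `[T, ∞)` is a cylinder flow on `[s, ∞)` for
  every `s ≥ T` (every field of the structure restricts; the open time-domain `U ⊇ [T, ∞)` of the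
  joint smoothness serves `[s, ∞) ⊆ [T, ∞)` as well).
* `helper_heightEnvelopeMonotone` — the HEIGHT ENVELOPE IS MONOTONE: for `T ≤ s ≤ t` every height
  `(F t x)₅` lies between two heights of the slice `M_s` (landed slab confinement
  `stub_slabConfinement`, restarted at time `s`).
* `helper_goodTimes` — GOOD TIMES: (i) `W(s) → 0` as `s → ∞` (in `ℝ≥0∞`): by the landed dissipation
  budget `IsCylinderMCF.dissipationBudget`, `∫⁻_{[T, t]} E ≤ μH⁴(F_T(M)) < ∞` for all `t ≥ T`, so
  the measure `ρ = E · (Lebesgue measure on [T, ∞))` is finite (continuity from below along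
  `[T, T + n] ↑ [T, ∞)`), its tails `ρ([s, ∞)) → ρ(∅) = 0` (continuity from above), and
  `W(s) ≤ ρ([s, ∞))` for `s ≥ T`; (ii) for every `s ≥ T` some `r ∈ [s, s + 1]` has `E(r) ≤ W(s)`:
  the first moment method (`MeasureTheory.exists_le_setLAverage`: an a.e.-measurable function does
  not exceed its average somewhere) on the window `[s, s + 1]` of Lebesgue measure `1`.  The
  a.e.-measurability of `E` on the window comes for free from the landed transport calculus:
  `E(r) = c⁻¹ · Φ(r)` with `Φ = -A'` on `(T, ∞)`, `A(r) = μ_r(M)` the area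
  (`IsCylinderMCF.lintegral_comap_normSq_deriv_eq`, `IsCylinderMCF.hasDerivAt_integral_density`),
  and the derivative of any real function is measurable (`measurable_deriv`).

Everything here is PROVED (no `sorry`, no definitions, no named facts).

References: G. Huisken, *Flow by mean curvature of convex surfaces into spheres*, J. Differential
Geom. 20 (1984), §3 (the area is a Lyapunov function: `d/dt Area = -∫ H²`); K. Brakke, *The motion
of a surface by its mean curvature* (1978), §3 (good times of the dissipation); P. Topping,
*Lectures on the Ricci flow* (2006), Thm. 3.1.1 (scalar maximum principle behind slab confinement).
-/

-- the prescribed namespace `Summit.SmoothPoincare4.SmoothPoincare4.…` repeats `SmoothPoincare4`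
set_option linter.dupNamespace false

noncomputable section

open Bundle Set Function Filter MeasureTheory Module
open scoped Manifold ContDiff Topology RealInnerProductSpace BigOperators ENNReal NNReal

namespace Summit.SmoothPoincare4.SmoothPoincare4.Cruxes.CylinderRungTwo.KillingFlux

open Literature.Geometry.Riemannian Literature.Geometry.Riemannian.EuclideanHypersurface
open Literature.Geometry.Lorentzian Literature.Geometry.Lorentzian.PseudoRiemannianMetric

/-! ## Two lemmas of pure measure theory on the real line -/

section MeasureTheory

/-- **Unit windows of a budgeted density tend to zero.** If `E : ℝ → ℝ≥0∞` has
`∫⁻_{[T, t]} E ≤ A < ∞` for every `t ≥ T`, then `∫⁻_{[s, s+1]} E → 0` as `s → ∞`: the measure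
`ρ = E · (Lebesgue ⌊ [T, ∞))` has `ρ([T, ∞)) ≤ A` (continuity from below), so its tails
`ρ([s, ∞)) → ρ(⋂ₛ [s, ∞)) = ρ(∅) = 0` (continuity from above), and `∫⁻_{[s, s+1]} E ≤ ρ([s, ∞))`
for `s ≥ T`.  No measurability of `E` is needed. [folklore] -/
theorem tendsto_setLIntegral_Icc_add_one_of_forall_le {E : ℝ → ℝ≥0∞} {T : ℝ} {A : ℝ≥0∞}
    (hA : A ≠ ⊤) (hb : ∀ t, T ≤ t → ∫⁻ r in Icc T t, E r ≤ A) :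
    Tendsto (fun s : ℝ => ∫⁻ r in Icc s (s + 1), E r) atTop (𝓝 0) := by
  set ρ : Measure ℝ := (volume.restrict (Ici T)).withDensity E with hρ
  have hρapp : ∀ S : Set ℝ, MeasurableSet S → ρ S = ∫⁻ r in S ∩ Ici T, E r := fun S hS => by
    rw [hρ, withDensity_apply _ hS, Measure.restrict_restrict hS]
  -- `ρ([T, ∞)) ≤ A`, by continuity from below along `[T, T + n]`
  have hIci : ρ (Ici T) ≤ A := by
    have hmono : Monotone fun n : ℕ => Icc T (T + n) := fun m n hmn =>
      Icc_subset_Icc le_rfl (by have h : (m : ℝ) ≤ n := Nat.cast_le.mpr hmn; linarith)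
    have hU : (⋃ n : ℕ, Icc T (T + n)) = Ici T := by
      ext r
      simp only [mem_iUnion, mem_Icc, mem_Ici]
      constructor
      · rintro ⟨n, h1, -⟩
        exact h1
      · intro hr
        obtain ⟨n, hn⟩ := exists_nat_ge (r - T)
        exact ⟨n, hr, by linarith⟩
    have htend : Tendsto (ρ ∘ fun n : ℕ => Icc T (T + n)) atTop
        (𝓝 (ρ (⋃ n : ℕ, Icc T (T + n)))) := tendsto_measure_iUnion_atTop hmono
    rw [hU] at htend
    refine le_of_tendsto' htend fun n => ?_
    rw [Function.comp_apply, hρapp _ measurableSet_Icc, inter_eq_left.2 Icc_subset_Ici_self]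
    exact hb _ (le_add_of_nonneg_right (Nat.cast_nonneg n))
  -- the tails `ρ([s, ∞))` tend to `ρ(∅) = 0`, by continuity from above
  have htail : Tendsto (fun s : ℝ => ρ (Ici s)) atTop (𝓝 0) := by
    have h1 : Tendsto (ρ ∘ Ici) atTop (𝓝 (ρ (⋂ s : ℝ, Ici s))) :=
      tendsto_measure_iInter_atTop (fun s => measurableSet_Ici.nullMeasurableSet)
        (fun a b hab => Ici_subset_Ici.2 hab) ⟨T, (hIci.trans_lt hA.lt_top).ne⟩
    have h2 : (⋂ s : ℝ, Ici s) = ∅ := by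
      ext r
      simp only [mem_iInter, mem_Ici, mem_empty_iff_false, iff_false, not_forall, not_le]
      exact ⟨r + 1, lt_add_one r⟩
    rw [h2, measure_empty] at h1
    exact h1
  -- comparison `0 ≤ ∫⁻_{[s, s+1]} E ≤ ρ([s, ∞))` for `s ≥ T`
  refine tendsto_of_tendsto_of_tendsto_of_le_of_le' tendsto_const_nhds htail
    (Eventually.of_forall fun s => zero_le) ?_
  filter_upwards [eventually_ge_atTop T] with s hs
  calc ∫⁻ r in Icc s (s + 1), E r ≤ ∫⁻ r in Ici s, E r := lintegral_mono_set Icc_subset_Ici_self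
    _ = ρ (Ici s) := by rw [hρapp _ measurableSet_Ici, inter_eq_left.2 (Ici_subset_Ici.2 hs)]

/-- **A density that is a multiple of (minus) a derivative is a.e.-measurable on compact windows.**
If `E(r) = c · (Φ r)⁺` (as `ENNReal.ofReal`) for `r ≥ T` and `A' = -Φ` on `(T, ∞)`, then `E` is
a.e.-measurable for Lebesgue measure restricted to `[s, t]`, `s ≥ T`: off the null endpoint `{s}` it
agrees with the measurable function `r ↦ c · (-(deriv A r))⁺` (`measurable_deriv`). [folklore] -/
theorem aemeasurable_restrict_Icc_of_hasDerivAt {E : ℝ → ℝ≥0∞} {A Φ : ℝ → ℝ} {T : ℝ} {c : ℝ≥0∞}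
    (hE : ∀ r, T ≤ r → E r = c * ENNReal.ofReal (Φ r))
    (hAd : ∀ r, T < r → HasDerivAt A (-Φ r) r) {s : ℝ} (hs : T ≤ s) (t : ℝ) :
    AEMeasurable E (volume.restrict (Icc s t)) := by
  have hg : Measurable fun r => c * ENNReal.ofReal (-deriv A r) :=
    (measurable_deriv A).neg.ennreal_ofReal.const_mul c
  rw [← Measure.restrict_congr_set Ioc_ae_eq_Icc]
  refine ⟨_, hg, ?_⟩
  rw [EventuallyEq, ae_restrict_iff' measurableSet_Ioc]
  refine Eventually.of_forall fun r hr => ?_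
  have hTr : T < r := hs.trans_lt hr.1
  rw [hE r hTr.le, (hAd r hTr).deriv, neg_neg]

end MeasureTheory

/-! ## Restart of a cylinder flow and the monotone height envelope -/

section Restart

variable {M : Type} [TopologicalSpace M] [ChartedSpace (EuclideanSpace ℝ (Fin 4)) M]
  [IsManifold (𝓡 4) ∞ M] {F ν : ℝ → M → EuclideanSpace ℝ (Fin 6)} {T : ℝ}

/-- **Restart of a cylinder flow**: a smooth mean curvature flow of embedded cross-sections of
`N = S⁴ × ℝ` on `[T, ∞)` is one on `[s, ∞)` for every `s ≥ T` (every field of `IsCylinderMCF`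
restricts from `t ≥ T` to `t ≥ s`; the open time-domain `U ⊇ [T, ∞) ⊇ [s, ∞)` of the joint
smoothness is kept). [folklore] -/
theorem IsCylinderMCF.of_le (h : IsCylinderMCF M F ν T) {s : ℝ} (hs : T ≤ s) :
    IsCylinderMCF M F ν s where
  contMDiffOn := by
    obtain ⟨U, hU, hTU, hFU⟩ := h.contMDiffOn
    exact ⟨U, hU, (Ici_subset_Ici.2 hs).trans hTU, hFU⟩
  isSmoothEmbedding t ht := h.isSmoothEmbedding t (hs.trans ht)
  mem_cyl t ht := h.mem_cyl t (hs.trans ht)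
  isSpacelikeImmersion t ht := h.isSpacelikeImmersion t (hs.trans ht)
  isUnitNormal t ht := h.isUnitNormal t (hs.trans ht)
  normal_tangent t ht := h.normal_tangent t (hs.trans ht)
  contMDiff_normal t ht := h.contMDiff_normal t (hs.trans ht)
  velocity_eq t ht x := h.velocity_eq t (hs.trans ht) x

end Restart

/-- **Registered helper `helper_heightEnvelopeMonotone` (W2-E): the height envelope of a cylinder
flow is monotone.** Along a smooth mean curvature flow `IsCylinderMCF M F ν T` of closed embedded
cross-sections of `N = S⁴ × ℝ`, for `T ≤ s ≤ t` the height `(F t x)₅` of every point of `M_t` lies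
between two heights of `M_s`: `∃ y y', (F s y)₅ ≤ (F t x)₅ ≤ (F s y')₅` — slab confinement
(`stub_slabConfinement`, maximum principle for the height) applied to the flow restarted at time `s`
(`IsCylinderMCF.of_le`). [folklore] -/
theorem helper_heightEnvelopeMonotone : ∀ (M : Type) [TopologicalSpace M] [T2Space M] [SecondCountableTopology M] [ChartedSpace (EuclideanSpace ℝ (Fin 4)) M] [IsManifold (𝓡 4) ∞ M] [CompactSpace M] (F : ℝ → M → EuclideanSpace ℝ (Fin 6)) (ν : ℝ → M → EuclideanSpace ℝ (Fin 6)) (T : ℝ), IsCylinderMCF M F ν T → ∀ s t : ℝ, T ≤ s → s ≤ t → ∀ x : M, ∃ y y' : M, F s y 5 ≤ F t x 5 ∧ F t x 5 ≤ F s y' 5 := by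
  intro M _ _ _ _ _ _ F ν T hF s t hs hst x
  exact stub_slabConfinement M F ν s (hF.of_le hs) t hst x

/-- **Registered helper `helper_goodTimes` (W2-F): good times of the dissipation.** Along a smooth
mean curvature flow `IsCylinderMCF M F ν T` of closed embedded cross-sections of `N = S⁴ × ℝ`, with
`E(r) = ∫⁻_M ‖∂_r F(r, ·)‖² d((F r)^* μH⁴)` the slice energy (`= ∫ H² dμ_r`):
(i) the dissipation over unit windows `∫⁻_{[s, s+1]} E → 0` as `s → ∞` (dissipation budget
`IsCylinderMCF.dissipationBudget` + finiteness of the initial area + continuity of the finite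
measure `E · Lebesgue` from above, `tendsto_setLIntegral_Icc_add_one_of_forall_le`); (ii) for
every `s ≥ T` some `r ∈ [s, s + 1]` is a GOOD TIME, `E(r) ≤ ∫⁻_{[s, s+1]} E` (first moment method
on a window of Lebesgue measure `1`; `E` is a.e.-measurable there because `E = c⁻¹ · (-A')` with
`A(r) = μ_r(M)` the area, `aemeasurable_restrict_Icc_of_hasDerivAt`). [folklore] -/
theorem helper_goodTimes : ∀ (M : Type) [TopologicalSpace M] [T2Space M] [SecondCountableTopology M] [ChartedSpace (EuclideanSpace ℝ (Fin 4)) M] [IsManifold (𝓡 4) ∞ M] [CompactSpace M] [MeasurableSpace M] [BorelSpace M] (F : ℝ → M → EuclideanSpace ℝ (Fin 6)) (ν : ℝ → M → EuclideanSpace ℝ (Fin 6)) (T : ℝ), IsCylinderMCF M F ν T → Filter.Tendsto (fun s : ℝ => ∫⁻ r in Set.Icc s (s + 1), ∫⁻ x, ENNReal.ofReal (‖deriv (fun s' => F s' x) r‖ ^ 2) ∂(Measure.comap (F r) (μH[4] : Measure (EuclideanSpace ℝ (Fin 6))))) Filter.atTop (𝓝 0) ∧ ∀ s : ℝ, T ≤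 s → ∃ r ∈ Set.Icc s (s + 1), ∫⁻ x, ENNReal.ofReal (‖deriv (fun s' => F s' x) r‖ ^ 2) ∂(Measure.comap (F r) (μH[4] : Measure (EuclideanSpace ℝ (Fin 6)))) ≤ ∫⁻ r' in Set.Icc s (s + 1), ∫⁻ x, ENNReal.ofReal (‖deriv (fun s' => F s' x) r'‖ ^ 2) ∂(Measure.comap (F r') (μH[4] : Measure (EuclideanSpace ℝ (Fin 6)))) := by
  intro M _ _ _ _ _ _ _ _ F ν T hF
  -- the budget: `∫⁻_{[T, t]} E ≤ μH⁴(F_T(M)) < ∞`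
  have hA : μH[4] (range (F T)) ≠ ⊤ :=
    (SphericalCylinderEntropy.hausdorffMeasure_range_lt_top_of_isSpacelikeImmersion
      (hF.isSpacelikeImmersion T le_rfl) (hF.injective le_rfl)).ne
  have hb : ∀ t, T ≤ t → (∫⁻ r in Icc T t, ∫⁻ x, ENNReal.ofReal (‖deriv (fun s' => F s' x) r‖ ^ 2)
      ∂(Measure.comap (F r) (μH[4] : Measure (EuclideanSpace ℝ (Fin 6))))) ≤ μH[4] (range (F T)) :=
    fun t ht => le_trans le_self_add (hF.dissipationBudget ht)
  refine ⟨tendsto_setLIntegral_Icc_add_one_of_forall_le hA hb, fun s hs => ?_⟩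
  -- a.e.-measurability of the slice energy on the window, from `E = c⁻¹ · (-A')`
  obtain ⟨c, hc0, hHE⟩ := exists_euclideanHausdorff_six_eq_smul
  have hae : AEMeasurable (fun r => ∫⁻ x, ENNReal.ofReal (‖deriv (fun s' => F s' x) r‖ ^ 2)
      ∂(Measure.comap (F r) (μH[4] : Measure (EuclideanSpace ℝ (Fin 6)))))
      (volume.restrict (Icc s (s + 1))) :=
    aemeasurable_restrict_Icc_of_hasDerivAt
      (fun r hr => hF.lintegral_comap_normSq_deriv_eq hr hc0 hHE)
      (fun r hr => hF.hasDerivAt_integral_density hr) hs (s + 1)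
  -- first moment method on the window `[s, s + 1]` of Lebesgue measure `1`
  have hvol : volume (Icc s (s + 1)) = 1 := by
    rw [Real.volume_Icc, add_sub_cancel_left, ENNReal.ofReal_one]
  obtain ⟨r, hr, hle⟩ := exists_le_setLAverage (μ := volume) (s := Icc s (s + 1))
    (by rw [hvol]; exact one_ne_zero) (by rw [hvol]; exact ENNReal.one_ne_top) hae
  refine ⟨r, hr, hle.trans_eq ?_⟩
  rw [setLAverage_eq, hvol, div_one]

end Summit.SmoothPoincare4.SmoothPoincare4.Cruxes.CylinderRungTwo.KillingFlux

end
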